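import Summits.FinalStateConjecture.FinalStateConjecture.Theses.BartnikGapSettling

/-!
# Sketch — crux idea `exact-minimiser-by-compactness` (crux-ideate r2 k5, stmt-FinalStateConjecture-10807)

First lemma of the line "stability is rigidity plus compactness": the EXACT (δ = γ = 0) case of the
repaired crux C″ (lead c1, `Lines/SketchRepairedStatement.lean`: `Λ < 1`, `N ≤ 1`, `p` in the collar for
`N = 1`), i.e. Bondi–Bartnik MINIMISERS with an exact thick Kerr collar on a bounded-geometry leaf carry,
for every target `(k, ε)`, an `(ε,k)`-near-Kerr leaf in their causal future.  The line proves
`ExactMinimiserRigidity ∧ (compactness + semicontinuity package) → C″`; here we only certify that the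
exact statement is correctly typed against C″ (`exact_of_repaired`: it is the special case δ = γ = 0).
-/

noncomputable section

set_option linter.dupNamespace false

open Set Filter Function Topology TopologicalSpace
open scoped Manifold ContDiff Topology ENNReal BigOperators

namespace Summit.FinalStateConjecture.FinalStateConjecture.Cruxes.BondiBartnikRigidity.ExactMinimiserByCompactness

/-- C″ verbatim (lead c1's minimal repair of the filed crux; copied so that this sketch is self-contained). -/
def Repaired : Prop :=
  open Literature.Geometry.Lorentzian in ∀ (χ m₀ : ℝ) (N₀ k : ℕ) (ε : ENNReal), χ < 1 → 0 < m₀ → 0 < ε → ∃ k' : ℕ, ∀ Λ : ENNReal, Λ < 1 → ∃ (δ : ENNReal) (γ : ℝ), 0 < δ ∧ 0 < γ ∧ ∀ (X : Type) [TopologicalSpace X] [ChartedSpace E3 X] [IsManifold (𝓡 3) ((⊤ : ℕ∞) : WithTop ℕ∞) X] [T2Space X] [SecondCountableTopology X] [ConnectedSpace X], ∀ D ∈ admissibleVacuumData X, ∀ (𝒟 : VacuumCauchyDevelopment D) (N : ℕ) (M a : Fin N → ℝ) (S : Set 𝒟.carrier) (p : 𝒟.carrier) (mo' : Fin N → lorentzGroup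 × E4) (B' : Fin N → ModelBackground) (Φ : ∀ i, (B' i).domain → 𝒟.carrier), 𝒟.IsMaximal → N ≤ N₀ → N ≤ 1 → (∀ i, m₀ ≤ M i ∧ M i ≤ m₀⁻¹ ∧ |a i| ≤ χ * M i) → 𝒟.toCauchyDevelopment.IsNearKerrLeaf k' Λ N M a S → p ∈ S → (N = 0 ∨ ∃ i, p ∈ Φ i '' (B' i).truncTimeSlab (3 * M i) 0) → (∀ i, B' i = starBackground (mo' i).1 (mo' i).2 (M i) (a i) (fun x => Kerr.radius (a i) (poincareInv (mo' i).1 (mo' i).2 x))) → (∀ i, ContMDiffOn 𝓘(ℝ, E4) (𝓡 4) ((⊤ : ℕ∞) : WithTop ℕ∞) (Φ i) {x | -1 < (B' i).time x.1 ∧ (B' i).time x.1 < 1 ∧ (B' i).radius x.1 < 3 * M i + 1} ∧ Topology.IsOpenEmbedding ({x | -1 < (B' i).time x.1 ∧ (B' i).time x.1 < 1 ∧ (B' i).radius x.1 < 3 * M i + 1}.restrict (Φ i))) → (∀ i, 𝒟.toSpacetime.truncDeviationCk (B' i) (Φ i) k' (3 * M i) 0 ≤ δ) → (∀ i, Φ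 i '' (B' i).truncTimeSlab (3 * M i) 0 ⊆ S) → Pairwise (Function.onFun Disjoint fun i => Φ i '' (B' i).truncTimeSlab (3 * M i) 0) → (∃ m : ℝ, 𝒟.toCauchyDevelopment.HasCutBondiMass ({p} ∪ ⋃ i, Φ i '' (B' i).truncTimeSlab (3 * M i) 0) m) → (∀ (X' : Type) [TopologicalSpace X'] [ChartedSpace E3 X'] [IsManifold (𝓡 3) ((⊤ : ℕ∞) : WithTop ℕ∞) X'] [T2Space X'] [SecondCountableTopology X'] [ConnectedSpace X'], ∀ D' ∈ admissibleVacuumData X', ∀ (𝒟' : VacuumCauchyDevelopment D') (U : Set 𝒟.carrier) (φ : 𝒟.carrier → 𝒟'.carrier) (m' : ℝ), 𝒟'.IsMaximal → IsOpen U → ({p} ∪ ⋃ i, Φ i '' (B' i).truncTimeSlab (3 * M i) 0) ⊆ U → ContMDiffOn (𝓡 4) (𝓡 4) ((⊤ : ℕ∞) : WithTop ℕ∞) φ U → Topology.IsOpenEmbedding (U.restrict φ) → (∀ q ∈ U, pullbackBilin (I := 𝓡 4) (I' := 𝓡 4) φ 𝒟'.metric.val q = 𝒟.metric.val q) → (∀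 q ∈ U, 𝒟'.timeOrientation.IsFutureDirected (mfderiv (𝓡 4) (𝓡 4) φ q (𝒟.timeOrientation.vectorField q))) → 𝒟'.toCauchyDevelopment.HasCutBondiMass (φ '' ({p} ∪ ⋃ i, Φ i '' (B' i).truncTimeSlab (3 * M i) 0)) m' → ∀ η : ℝ, 0 < η → ∃ m : ℝ, 𝒟.toCauchyDevelopment.HasCutBondiMass ({p} ∪ ⋃ i, Φ i '' (B' i).truncTimeSlab (3 * M i) 0) m ∧ m ≤ m' + γ + η) → ∃ S' : Set 𝒟.carrier, 𝒟.toCauchyDevelopment.IsNearKerrLeaf k ε N M a S' ∧ S' ⊆ 𝒟.metric.causalFuture 𝒟.timeOrientation S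

/-- **Exact minimiser rigidity** — the `δ = γ = 0` case of C″: an MGHD of admissible vacuum data containing a
`(Λ, k')`-near-Kerr leaf `S` (`Λ < 1`) through a point `p`, with `N ≤ 1` thick collar charts that are EXACT
Kerr–star charts (`truncDeviationCk … ≤ 0`) and whose core realises the Bondi–Bartnik infimum
(`m ≤ m' + η` for every competitor and every `η > 0`), contains an `(ε, k)`-near-Kerr leaf in `J⁺(S)`.
The compactness line reduces C″ to this statement plus a semicontinuity package; for `N = 0` it is the
rigidity case of the Chruściel–Paetz light-cone mass theorem (arXiv:1401.3789, p. 4), for `N = 1` it is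
"minimisers of the cut-energy functional with Kerr jet are Kerr" (Euler–Lagrange on the cone). -/
def ExactMinimiserRigidity : Prop :=
  open Literature.Geometry.Lorentzian in ∀ (χ m₀ : ℝ) (N₀ k : ℕ) (ε : ENNReal), χ < 1 → 0 < m₀ → 0 < ε → ∃ k' : ℕ, ∀ Λ : ENNReal, Λ < 1 → ∀ (X : Type) [TopologicalSpace X] [ChartedSpace E3 X] [IsManifold (𝓡 3) ((⊤ : ℕ∞) : WithTop ℕ∞) X] [T2Space X] [SecondCountableTopology X] [ConnectedSpace X], ∀ D ∈ admissibleVacuumData X, ∀ (𝒟 : VacuumCauchyDevelopment D) (N : ℕ) (M a : Fin N → ℝ) (S : Set 𝒟.carrier) (p : 𝒟.carrier) (mo' : Fin N → lorentzGroup × E4) (B' : Fin N → ModelBackground) (Φ : ∀ i, (B' i).domain → 𝒟.carrier), 𝒟.IsMaximal → N ≤ N₀ → N ≤ 1 → (∀ i, m₀ ≤ M i ∧ M i ≤ m₀⁻¹ ∧ |a i| ≤ χ * M i) → 𝒟.toCauchyDevelopment.IsNearKerrLeaf k' Λ N M a S → p ∈ S → (N = 0 ∨ ∃ i, p ∈ Φ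 i '' (B' i).truncTimeSlab (3 * M i) 0) → (∀ i, B' i = starBackground (mo' i).1 (mo' i).2 (M i) (a i) (fun x => Kerr.radius (a i) (poincareInv (mo' i).1 (mo' i).2 x))) → (∀ i, ContMDiffOn 𝓘(ℝ, E4) (𝓡 4) ((⊤ : ℕ∞) : WithTop ℕ∞) (Φ i) {x | -1 < (B' i).time x.1 ∧ (B' i).time x.1 < 1 ∧ (B' i).radius x.1 < 3 * M i + 1} ∧ Topology.IsOpenEmbedding ({x | -1 < (B' i).time x.1 ∧ (B' i).time x.1 < 1 ∧ (B' i).radius x.1 < 3 * M i + 1}.restrict (Φ i))) → (∀ i, 𝒟.toSpacetime.truncDeviationCk (B' i) (Φ i) k' (3 * M i) 0 ≤ 0) → (∀ i, Φ i '' (B' i).truncTimeSlab (3 * M i) 0 ⊆ S) → Pairwise (Function.onFun Disjoint fun i => Φ i '' (B' i).truncTimeSlab (3 * M i) 0) → (∃ m : ℝ, 𝒟.toCauchyDevelopment.HasCutBondiMass ({p} ∪ ⋃ i, Φ i '' (B' i).truncTimeSlab (3 * M i) 0) m) → (∀ (X' : Type) [TopologicalSpace X'] [ChartedSpace E3 X']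 [IsManifold (𝓡 3) ((⊤ : ℕ∞) : WithTop ℕ∞) X'] [T2Space X'] [SecondCountableTopology X'] [ConnectedSpace X'], ∀ D' ∈ admissibleVacuumData X', ∀ (𝒟' : VacuumCauchyDevelopment D') (U : Set 𝒟.carrier) (φ : 𝒟.carrier → 𝒟'.carrier) (m' : ℝ), 𝒟'.IsMaximal → IsOpen U → ({p} ∪ ⋃ i, Φ i '' (B' i).truncTimeSlab (3 * M i) 0) ⊆ U → ContMDiffOn (𝓡 4) (𝓡 4) ((⊤ : ℕ∞) : WithTop ℕ∞) φ U → Topology.IsOpenEmbedding (U.restrict φ) → (∀ q ∈ U, pullbackBilin (I := 𝓡 4) (I' := 𝓡 4) φ 𝒟'.metric.val q = 𝒟.metric.val q) → (∀ q ∈ U, 𝒟'.timeOrientation.IsFutureDirected (mfderiv (𝓡 4) (𝓡 4) φ q (𝒟.timeOrientation.vectorField q))) → 𝒟'.toCauchyDevelopment.HasCutBondiMass (φ '' ({p} ∪ ⋃ i, Φ i '' (B' i).truncTimeSlab (3 * M i) 0)) m' → ∀ η : ℝ, 0 < η → ∃ m : ℝ, 𝒟.toCauchyDevelopment.HasCutBondiMass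 ({p} ∪ ⋃ i, Φ i '' (B' i).truncTimeSlab (3 * M i) 0) m ∧ m ≤ m' + η) → ∃ S' : Set 𝒟.carrier, 𝒟.toCauchyDevelopment.IsNearKerrLeaf k ε N M a S' ∧ S' ⊆ 𝒟.metric.causalFuture 𝒟.timeOrientation S

/-- Sanity: the exact statement is the special case `δ = γ = 0` of C″ (so the line's transfer target is
typed against the repaired crux, not against an analogue). -/
theorem exact_of_repaired (h : Repaired) : ExactMinimiserRigidity := by
  intro χ m₀ N₀ k ε hχ hm₀ hε
  obtain ⟨k', hk'⟩ := h χ m₀ N₀ k ε hχ hm₀ hε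
  refine ⟨k', fun Λ hΛ => ?_⟩
  obtain ⟨δ, γ, hδ, hγ, H⟩ := hk' Λ hΛ
  intro X _ _ _ _ _ _ D hD 𝒟 N M a S p mo' B' Φ hmax hN hN1 hwin hleaf hp hpc hB hΦ hdev hsub hdis hcut hgap
  refine H X D hD 𝒟 N M a S p mo' B' Φ hmax hN hN1 hwin hleaf hp hpc hB hΦ
    (fun i => (hdev i).trans bot_le) hsub hdis hcut ?_
  intro X' _ _ _ _ _ _ D' hD' 𝒟' U φ m' h1 h2 h3 h4 h5 h6 h7 h8 η hη
  obtain ⟨m, hm, hle⟩ := hgap X' D' hD' 𝒟' U φ m' h1 h2 h3 h4 h5 h6 h7 h8 η hη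
  exact ⟨m, hm, by linarith⟩

end Summit.FinalStateConjecture.FinalStateConjecture.Cruxes.BondiBartnikRigidity.ExactMinimiserByCompactness

end
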